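import Summits.KontsevichZagierPeriods.KontsevichZagierPeriods.Theses.TorsionLogs
import Summits.KontsevichZagierPeriods.KontsevichZagierPeriods.Theorems.HurwitzMicroSectorsNormalFormPrincipleDimOneAssembly

/-!
# Route KontsevichZagierPeriods/TorsionLogs — crux `TorsionSectorComplete` (stmt-KontsevichZagierPeriods-14212),
# line `birth`, stub `stub_surfaceKernel`: its unconditional rational dimension-`≤ 1` shadow

Helper file (`--supports stmt-KontsevichZagierPeriods-14212`, registered sub-goal
`stub_surfaceKernel_dimLeOne`) of the stub-worker on the skeleton stub `stub_surfaceKernel` of the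
line `birth` of the conjecture-grade crux
`Summit.KontsevichZagierPeriods.KontsevichZagierPeriods.Theses.TorsionLogs.TorsionSectorComplete`
(for `r`, `r'` of KZ's rational shape with equal values, `[r] − [r'] ∈ KZ.relations ⊔ closure T`,
`T` the tied Néron–torsion elements `M•[rI] + k•[rP] − m•[rL]` of a real elliptic curve, written out
verbatim below).

The full stub `stub_surfaceKernel` — every element of the SURFACE LAYER
`closure {[s] | s : KZ.IntegralRep k, k ≤ 2}` with value `0` lies in `KZ.relations ⊔ closure T` —
is conjecture-grade: it is the Kontsevich–Zagier period conjecture for all integral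
representations of dimension `≤ 2` inside the three rules (it already contains every `ℤ`-linear
relation among real `1`-periods of curves, elliptic periods and quasi-periods, curved planar areas
and the dilogarithm layer), it is implied by the crux, and it follows from the registered OPEN
statement `Literature.NumberTheory.Transcendental.KZKernelConjecture` (`ker eval ≤ relations`,
tree-equivalent to the summit `KontsevichZagierPeriods`). It is NOT proved or restated here.

What IS a theorem of the tree today is its rational dimension-`≤ 1` shadow, recorded in this file:
a formal `ℤ`-combination of representations of KZ's rational shape of dimensions `≤ 1` whose value
vanishes is already a Kontsevich–Zagier relation —
`Summit.KontsevichZagierPeriods.HurwitzMicroSectors.NormalFormPrinciple.PiBox.Dlog.mem_relations_of_eval_eq_zero_of_dim_le_one`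
(mixed normal forms of one-dimensional rational representations; a vanishing normal form is zero by
Baker's theorem, proved in the tree) — hence a fortiori lies in `KZ.relations ⊔ closure T`
(`stub_surfaceKernel_dimLeOne`). The layer it speaks about, `closure {[s] | dim s ≤ 1, s rational}`,
is a sublayer of the surface layer of the stub (`closure_rational_dim_le_one_le_surfaceLayer`), so
the shadow is literally the restriction of `stub_surfaceKernel` to that sublayer; the lattice form
`(closure {…}) ⊓ ker eval ≤ relations ⊔ closure T` is `closure_rational_dim_le_one_inf_ker_le`.
Values covered: `ℚ̄ ∩ ℝ`, `ℚ̄`-combinations of logarithms of algebraic numbers and `π`.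

Sources: M. Kontsevich, D. Zagier, *Periods* (2001), §1.2 Conjecture 1; A. Baker, *Transcendental
Number Theory* (1975), Thm. 2.1. No definition is introduced; `T` is written out verbatim.
-/

namespace Summit.KontsevichZagierPeriods.TorsionLogs.TorsionSectorComplete

/-- **Registered sub-goal `stub_surfaceKernel_dimLeOne` — the rational dimension-`≤ 1` shadow of
the skeleton stub `stub_surfaceKernel` (unconditional).** Every formal `ℤ`-combination `y` of
integral representations of KZ's rational shape of dimensions `≤ 1` with `KZ.eval y = 0` lies in
`KZ.relations ⊔ closure T` — indeed already in `KZ.relations`, by Conjecture 1 in dimension `≤ 1`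
in kernel form (`PiBox.Dlog.mem_relations_of_eval_eq_zero_of_dim_le_one`, Baker's theorem inside),
and `KZ.relations ≤ KZ.relations ⊔ closure T`.
[Kontsevich–Zagier 2001, §1.2 Conjecture 1; Baker 1975, Thm. 2.1] [folklore] -/
theorem stub_surfaceKernel_dimLeOne :
    ∀ y ∈ AddSubgroup.closure {c : Literature.NumberTheory.Transcendental.KZ.FormalRep | ∃ (k : ℕ) (s : Literature.NumberTheory.Transcendental.KZ.IntegralRep k), k ≤ 1 ∧ s.IsRational ∧ c = Literature.NumberTheory.Transcendental.KZ.of s}, Literature.NumberTheory.Transcendental.KZ.eval y = 0 → y ∈ Literature.NumberTheory.Transcendental.KZ.relations ⊔ AddSubgroup.closure {d : Literature.NumberTheory.Transcendental.KZ.FormalRep | ∃ (g₂ g₃ e₁ xP yP α : ℝ) (N a : ℕ) (M k m : ℤ) (f : ℝ → ℝ) (rI rP : Literature.NumberTheory.Transcendental.KZ.IntegralRep 2) (rL : Literature.NumberTheory.Transcendental.KZ.IntegralRep 1), (∀ x, f x = 4 * x ^ 3 - g₂ * x - g₃) ∧ g₂ ^ 3 - 27 * g₃ ^ 2 ≠ 0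 ∧ f e₁ = 0 ∧ 0 < e₁ ∧ (∀ x, e₁ < x → 0 < f x) ∧ e₁ < xP ∧ yP ^ 2 = f xP ∧ 3 ≤ N ∧ 0 < a ∧ 2 * a < N ∧ 4 * (N : ℤ) ^ 2 * k = M * ((N : ℤ) - 2 * (a : ℤ)) ^ 2 ∧ (∀ hns : (⟨0, 0, 0, -g₂ / 4, -g₃ / 4⟩ : WeierstrassCurve ℝ).toAffine.Nonsingular xP (yP / 2), addOrderOf (WeierstrassCurve.Affine.Point.some xP (yP / 2) hns) = N) ∧ (N : ℝ) * (∫ x in Set.Ioi xP, (Real.sqrt (f x))⁻¹) = a * (2 * ∫ x in Set.Ioi e₁, (Real.sqrt (f x))⁻¹) ∧ 1 < α ∧ rI.domain = {z | e₁ < z 1 ∧ z 1 < z 0 ∧ z 0 < xP} ∧ Set.EqOn rI.integrand (fun z => z 1 / (Real.sqrt (f (z 1)) * Real.sqrt (f (z 0)))) rI.domain ∧ rP.domain = {z | e₁ < z 0 ∧ e₁ < z 1} ∧ Set.EqOn rP.integrand (fun z => (Real.sqrt (f (z 0)))⁻¹ * ((g₂ * z 1 + 2 * g₃) / (2 * (z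 1) ^ 2 * Real.sqrt (f (z 1))))) rP.domain ∧ rL.domain = {t | 1 < t 0 ∧ t 0 < α} ∧ Set.EqOn rL.integrand (fun t => (t 0)⁻¹) rL.domain ∧ (M : ℝ) * rI.value + k * rP.value = m * rL.value ∧ d = M • Literature.NumberTheory.Transcendental.KZ.of rI + k • Literature.NumberTheory.Transcendental.KZ.of rP - m • Literature.NumberTheory.Transcendental.KZ.of rL} := by
  intro y hy hv
  exact AddSubgroup.mem_sup_left
    (Summit.KontsevichZagierPeriods.HurwitzMicroSectors.NormalFormPrinciple.PiBox.Dlog.mem_relations_of_eval_eq_zero_of_dim_le_one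
      hy hv)

/-- **The rational dimension-`≤ 1` layer is a sublayer of the surface layer.** The subgroup
generated by the classes `[s]` of representations of KZ's rational shape of dimension `≤ 1` is
contained in the surface layer `closure {[s] | s : KZ.IntegralRep k, k ≤ 2}` of the stub
`stub_surfaceKernel`; so `stub_surfaceKernel_dimLeOne` is the restriction of that stub to this
sublayer. [folklore] -/
theorem closure_rational_dim_le_one_le_surfaceLayer :
    AddSubgroup.closure {c : Literature.NumberTheory.Transcendental.KZ.FormalRep |
        ∃ (k : ℕ) (s : Literature.NumberTheory.Transcendental.KZ.IntegralRep k),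
          k ≤ 1 ∧ s.IsRational ∧ c = Literature.NumberTheory.Transcendental.KZ.of s} ≤
      AddSubgroup.closure {c : Literature.NumberTheory.Transcendental.KZ.FormalRep |
        ∃ (k : ℕ) (s : Literature.NumberTheory.Transcendental.KZ.IntegralRep k),
          k ≤ 2 ∧ c = Literature.NumberTheory.Transcendental.KZ.of s} :=
  AddSubgroup.closure_mono (by
    rintro c ⟨k, s, hk, -, rfl⟩
    exact ⟨k, s, by omega, rfl⟩)

/-- **Lattice form of the shadow.** The intersection of the rational dimension-`≤ 1` layer with
`ker KZ.eval` is contained in `KZ.relations ⊔ closure T` (`T` verbatim) — the kernel-form reading of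
`stub_surfaceKernel_dimLeOne`. [Kontsevich–Zagier 2001, §1.2 Conjecture 1] [folklore] -/
theorem closure_rational_dim_le_one_inf_ker_le :
    AddSubgroup.closure {c : Literature.NumberTheory.Transcendental.KZ.FormalRep |
        ∃ (k : ℕ) (s : Literature.NumberTheory.Transcendental.KZ.IntegralRep k),
          k ≤ 1 ∧ s.IsRational ∧ c = Literature.NumberTheory.Transcendental.KZ.of s} ⊓
        Literature.NumberTheory.Transcendental.KZ.eval.ker ≤
      Literature.NumberTheory.Transcendental.KZ.relations ⊔ AddSubgroup.closure {d : Literature.NumberTheory.Transcendental.KZ.FormalRep | ∃ (g₂ g₃ e₁ xP yP α : ℝ) (N a : ℕ) (M k m : ℤ) (f : ℝ → ℝ) (rI rP : Literature.NumberTheory.Transcendental.KZ.IntegralRep 2) (rL : Literature.NumberTheory.Transcendental.KZ.IntegralRep 1), (∀ x, f x = 4 * x ^ 3 - g₂ * x - g₃) ∧ g₂ ^ 3 - 27 * g₃ ^ 2 ≠ 0 ∧ f e₁ = 0 ∧ 0 < e₁ ∧ (∀ x, e₁ < x → 0 < f x) ∧ e₁ < xP ∧ yP ^ 2 = f xP ∧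 3 ≤ N ∧ 0 < a ∧ 2 * a < N ∧ 4 * (N : ℤ) ^ 2 * k = M * ((N : ℤ) - 2 * (a : ℤ)) ^ 2 ∧ (∀ hns : (⟨0, 0, 0, -g₂ / 4, -g₃ / 4⟩ : WeierstrassCurve ℝ).toAffine.Nonsingular xP (yP / 2), addOrderOf (WeierstrassCurve.Affine.Point.some xP (yP / 2) hns) = N) ∧ (N : ℝ) * (∫ x in Set.Ioi xP, (Real.sqrt (f x))⁻¹) = a * (2 * ∫ x in Set.Ioi e₁, (Real.sqrt (f x))⁻¹) ∧ 1 < α ∧ rI.domain = {z | e₁ < z 1 ∧ z 1 < z 0 ∧ z 0 < xP} ∧ Set.EqOn rI.integrand (fun z => z 1 / (Real.sqrt (f (z 1)) * Real.sqrt (f (z 0)))) rI.domain ∧ rP.domain = {z | e₁ < z 0 ∧ e₁ < z 1} ∧ Set.EqOn rP.integrand (fun z => (Real.sqrt (f (z 0)))⁻¹ * ((g₂ * z 1 + 2 * g₃) / (2 * (z 1) ^ 2 * Real.sqrt (f (z 1))))) rP.domain ∧ rL.domain = {t | 1 < t 0 ∧ t 0 < α} ∧ Set.EqOn rL.integrand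 (fun t => (t 0)⁻¹) rL.domain ∧ (M : ℝ) * rI.value + k * rP.value = m * rL.value ∧ d = M • Literature.NumberTheory.Transcendental.KZ.of rI + k • Literature.NumberTheory.Transcendental.KZ.of rP - m • Literature.NumberTheory.Transcendental.KZ.of rL} := by
  rintro y ⟨hy, hv⟩
  exact stub_surfaceKernel_dimLeOne y hy ((AddMonoidHom.mem_ker).mp hv)

end Summit.KontsevichZagierPeriods.TorsionLogs.TorsionSectorComplete
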